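import Mathlib
import Summits.ValiantsHypothesis.ValiantsHypothesis.Theses.LiouvilleSarnak
import Summits.ValiantsHypothesis.ValiantsHypothesis.Theorems.LiouvilleSarnakAlignedCutRank

/-!
# Route LiouvilleSarnak — the rung `LiouvilleCutRankFour` (stmt-ValiantsHypothesis-21039), PROVED

`LiouvilleCutRankFour` (the `W = 4` instance of the open crux `LiouvilleCutRank`, stmt-14775): there is
`n₀` (here `n₀ = 3`) such that for every `n ≥ n₀` and EVERY balanced cut `π : Fin n ⊕ Fin n ≃ Fin (2n)`
of the `2n` bit positions into `n` row bits and `n` column bits, the `2^n × 2^n` sign matrix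
`M_π(r, c) = λ(N_π(r, c) + 1)` (`λ` = Liouville, `N_π(r, c)` the number whose little-endian bit `j` is
read off the row vector `r` or the column vector `c` according to `π.symm j`) has rank `≥ 4` over `ℂ`.

Proof (the refuter's plan `PLAN21039.md` / candidate `CandidateProof21039.lean` on the item,
re-derived here against the tree; elementary, a finite certificate on `λ|[1,32]`):

* §1 `λ(K + 1)` for `K < 32` as a bitmask (`simp` with the `Nat.primeFactorsList_ofNat` simproc).
* §2 CERTIFICATE (`decide`): for each of the 20 five-letter row/column words with two or three row
  letters, four row assignments and four column assignments (packed into two 20-bit numbers per word)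
  whose `4 × 4` matrix `(λ(K(a, b) + 1))_{a,b}` — `K(a, b) < 32` the number read off the window — has
  determinant `≠ 0` (in fact `±8`).
* §3 WINDOW EMBEDDING: for a window `s, …, s+4` of bit positions set every bit below the window to `1`
  and every bit above it to `0`; then `N + 1 = 2^s (K + 1)`, so by complete multiplicativity
  (`λ(2^s x) = (-1)^s λ(x)`, tree lemma `LiouvilleSarnakAligned.liouville_two_pow_mul`) the corresponding
  `4 × 4` submatrix of `M_π` is `± ` the certificate matrix, which is invertible over `ℂ`; hence
  `4 ≤ rank M_π` (`Matrix.rank_submatrix_le`).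
* §4 COUNTING: a `0/1` word of length `2n ≥ 6` with `n` ones and `n` zeros has five consecutive
  positions carrying two or three ones (window counts move by `≤ 1` per shift, so avoiding `{2, 3}`
  forces `≤ 1` one in every window or `≤ 1` zero in every window, and then that letter occurs
  `≤ 2n/5 + 1 < n` times).
* §5 assembly with `n₀ = 3`.

Honest framing: this is the finite rung `W = 4` only; the crux `LiouvilleCutRank` (every `W`),
`DigitalBilinearLiouville` and `AlgebraicSarnak` stay open, and nothing here bears on VP versus VNP.
No new definitions (the certificate data are literals inside the statements of §2).
-/

-- the problem directory `ValiantsHypothesis/ValiantsHypothesis` repeats the summit name (tree layout)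
set_option linter.dupNamespace false

namespace Summit.ValiantsHypothesis.ValiantsHypothesis.Theorems.LiouvilleSarnakCutRankFour

open ArithmeticFunction
open Summit.ValiantsHypothesis.ValiantsHypothesis.Theorems.LiouvilleSarnakAligned (liouville_two_pow_mul)

/-! ### §1 The Liouville function on `[1, 32]` -/

/-- `λ(K + 1)` for `K < 32`, packed as the bitmask `61924137 = Σ {2^K : λ(K+1) = 1}`
(`λ = +1` exactly at `1, 4, 6, 9, 10, 14, 15, 16, 21, 22, 24, 25, 26`). [folklore] -/
theorem liouville_succ_eq (K : ℕ) (hK : K < 32) :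
    liouville (K + 1) = if Nat.testBit 61924137 K then 1 else -1 := by
  interval_cases K <;>
    simp [liouville_apply, cardFactors_apply, Nat.primeFactorsList_ofNat,
      Nat.testBit_eq_decide_div_mod_eq]

/-! ### §2 The certificate: twenty nonsingular `4 × 4` sign matrices -/

/-- **Certificate.** For every window word `m < 32` (bit `k` set iff window position `k` is a row
bit) with two or three row bits, the packed row assignments `X(m)` and column assignments `Y(m)`
(bits `5a + k`, `a < 4`, of the listed numbers) give a `4 × 4` matrix
`(λ(K(a,b) + 1))_{a,b}`, `K(a,b) = Σ_k 2^k · (row bit ? X(m)_{5a+k} : Y(m)_{5b+k})`, of nonzero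
determinant (checked by `decide`; all twenty determinants are `±8`). [folklore] -/
theorem cert_det_ne_zero : ∀ m < 32,
    (Nat.count (fun k => Nat.testBit m k = true) 5 = 2 ∨
      Nat.count (fun k => Nat.testBit m k = true) 5 = 3) →
    Matrix.det (Matrix.of fun a b : Fin 4 =>
      if Nat.testBit 61924137 (Nat.ofBits fun k : Fin 5 =>
          if Nat.testBit m k then
            Nat.testBit (([0, 0, 0, 99392, 0, 164992, 198784, 38976, 0, 296192, 329984, 329984, 397568,
              397568, 209152, 0, 0, 558592, 592384, 592384, 659968, 659968, 594432, 0, 795136, 303616,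
              74240, 0, 139776, 0, 0, 0] : List ℕ).getD m 0) (5 * (a : ℕ) + k)
          else
            Nat.testBit (([0, 0, 0, 139776, 0, 74240, 303616, 795136, 0, 594432, 659968, 659968, 592384,
              592384, 558592, 0, 0, 209152, 397568, 397568, 329984, 329984, 296192, 0, 38976, 198784,
              164992, 0, 99392, 0, 0, 0] : List ℕ).getD m 0) (5 * (b : ℕ) + k))
      then (1 : ℤ) else -1) ≠ 0 := by
  decide

/-! ### §3 Window embedding: a good window gives rank `≥ 4` -/

/-- **Window embedding.** Let `s, …, s+4` be a window of bit positions of the cut `π`, `m` its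
row/column word (`m.testBit k ↔` position `s + k` is a row bit) and `X, Y` packed row/column
assignments whose certificate matrix (§2) is nonsingular. Then `4 ≤ rank M_π`: setting the bits
below the window to `1` and above it to `0` gives `N + 1 = 2^s (K + 1)` and
`λ(2^s (K+1)) = (-1)^s λ(K+1)`, so the `4 × 4` submatrix of `M_π` on these rows/columns is
`(-1)^s` times the certificate matrix, invertible over `ℂ`. [folklore] -/
theorem four_le_rank_of_window (n : ℕ) (π : Fin n ⊕ Fin n ≃ Fin (2 * n)) (s : ℕ)
    (hs : s + 5 ≤ 2 * n) (m X Y : ℕ)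
    (hm : ∀ j : Fin (2 * n), s ≤ (j : ℕ) → (j : ℕ) < s + 5 → Nat.testBit m (j - s) = (π.symm j).isLeft)
    (hdet : Matrix.det (Matrix.of fun a b : Fin 4 =>
        if Nat.testBit 61924137 (Nat.ofBits fun k : Fin 5 =>
            if Nat.testBit m k then Nat.testBit X (5 * (a : ℕ) + k)
            else Nat.testBit Y (5 * (b : ℕ) + k))
        then (1 : ℤ) else -1) ≠ 0) :
    4 ≤ (Matrix.of fun r c : Fin n → Bool =>
      (((liouville (Nat.ofBits (fun j : Fin (2 * n) => Sum.elim r c (π.symm j)) + 1) : ℤ) : ℂ))).rank := by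
  classical
  set C : Matrix (Fin 4) (Fin 4) ℤ := Matrix.of fun a b : Fin 4 =>
        if Nat.testBit 61924137 (Nat.ofBits fun k : Fin 5 =>
            if Nat.testBit m k then Nat.testBit X (5 * (a : ℕ) + k)
            else Nat.testBit Y (5 * (b : ℕ) + k))
        then (1 : ℤ) else -1 with hC
  set M : Matrix (Fin n → Bool) (Fin n → Bool) ℂ := Matrix.of fun r c : Fin n → Bool =>
      (((liouville (Nat.ofBits (fun j : Fin (2 * n) => Sum.elim r c (π.symm j)) + 1) : ℤ) : ℂ))
    with hM
  -- extension of a local window stream to all positions: ones below the window, zeros above it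
  let ext : (ℕ → Bool) → ℕ → Bool := fun z j =>
    if j < s then true else if j < s + 5 then z (j - s) else false
  let xr : Fin 4 → ℕ → Bool := fun a k => Nat.testBit X (5 * (a : ℕ) + k)
  let yc : Fin 4 → ℕ → Bool := fun b k => Nat.testBit Y (5 * (b : ℕ) + k)
  let ρ : Fin 4 → (Fin n → Bool) := fun a i => ext (xr a) (π (Sum.inl i))
  let γ : Fin 4 → (Fin n → Bool) := fun b i => ext (yc b) (π (Sum.inr i))
  let z : Fin 4 → Fin 4 → ℕ → Bool := fun a b k => if Nat.testBit m k then xr a k else yc b k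
  -- (1) the global bit vector at `(ρ a, γ b)` is the extension of the merged local stream
  have hglob : ∀ a b (j : Fin (2 * n)), Sum.elim (ρ a) (γ b) (π.symm j) = ext (z a b) j := by
    intro a b j
    rcases hj : π.symm j with i | i
    · have hji : π (Sum.inl i) = j := by rw [← hj, Equiv.apply_symm_apply]
      rw [Sum.elim_inl]
      show ext (xr a) (π (Sum.inl i)) = ext (z a b) j
      rw [hji]
      by_cases h1 : (j : ℕ) < s
      · simp [ext, h1]
      · by_cases h2 : (j : ℕ) < s + 5
        · have ht : Nat.testBit m (j - s) = true := by
            rw [hm j (not_lt.mp h1) h2, hj, Sum.isLeft_inl]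
          simp [ext, z, h1, h2, ht]
        · simp [ext, h1, h2]
    · have hji : π (Sum.inr i) = j := by rw [← hj, Equiv.apply_symm_apply]
      rw [Sum.elim_inr]
      show ext (yc b) (π (Sum.inr i)) = ext (z a b) j
      rw [hji]
      by_cases h1 : (j : ℕ) < s
      · simp [ext, h1]
      · by_cases h2 : (j : ℕ) < s + 5
        · have ht : Nat.testBit m (j - s) = false := by
            rw [hm j (not_lt.mp h1) h2, hj, Sum.isLeft_inr]
          simp [ext, z, h1, h2, ht]
        · simp [ext, h1, h2]
  -- (2) the number with extended bits: `N + 1 = 2^s (K + 1)`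
  have hext : ∀ zz : ℕ → Bool,
      Nat.ofBits (fun j : Fin (2 * n) => ext zz j) + 1 = 2 ^ s * (Nat.ofBits (fun k : Fin 5 => zz k) + 1) := by
    intro zz
    have h1 : Nat.ofBits (fun j : Fin (2 * n) => ext zz j) =
        2 ^ s * Nat.ofBits (fun k : Fin 5 => zz k) + (2 ^ s - 1) := by
      apply Nat.eq_of_testBit_eq
      intro i
      rw [Nat.testBit_ofBits, Nat.testBit_two_pow_mul_add _ (Nat.sub_lt (Nat.two_pow_pos s) Nat.one_pos),
        Nat.testBit_two_pow_sub_one, Nat.testBit_ofBits]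
      simp only [ext]
      split_ifs <;> simp_all <;> omega
    rw [h1, Nat.mul_add, mul_one, Nat.add_assoc, Nat.sub_add_cancel Nat.one_le_two_pow]
  -- (3) entries of the submatrix
  have hentry : ∀ a b, M (ρ a) (γ b) = (-1 : ℂ) ^ s * ((C a b : ℤ) : ℂ) := by
    intro a b
    have hfun : (fun j : Fin (2 * n) => Sum.elim (ρ a) (γ b) (π.symm j)) =
        fun j : Fin (2 * n) => ext (z a b) j := funext (hglob a b)
    have hN : Nat.ofBits (fun j : Fin (2 * n) => Sum.elim (ρ a) (γ b) (π.symm j)) + 1 =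
        2 ^ s * (Nat.ofBits (fun k : Fin 5 => z a b k) + 1) := by
      rw [hfun]; exact hext (z a b)
    have hK : Nat.ofBits (fun k : Fin 5 => z a b k) < 32 := Nat.ofBits_lt_two_pow _
    have hCab : C a b = if Nat.testBit 61924137 (Nat.ofBits fun k : Fin 5 => z a b k) then 1 else -1 := rfl
    simp only [hM, Matrix.of_apply]
    rw [hN, liouville_two_pow_mul, liouville_succ_eq _ hK, hCab]
    push_cast
    split_ifs <;> simp
  -- (4) the submatrix is `(-1)^s •` the certificate matrix, hence invertible of rank 4
  have hsub : M.submatrix ρ γ = ((-1 : ℂ) ^ s) • C.map (fun x : ℤ => (x : ℂ)) := by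
    ext a b
    simp only [Matrix.submatrix_apply, Matrix.smul_apply, Matrix.map_apply, smul_eq_mul]
    exact hentry a b
  have hdetC : (C.map (fun x : ℤ => (x : ℂ))).det ≠ 0 := by
    rw [← Int.cast_det]
    exact_mod_cast hdet
  have hunit : IsUnit (M.submatrix ρ γ) := by
    rw [Matrix.isUnit_iff_isUnit_det, hsub, Matrix.det_smul, isUnit_iff_ne_zero]
    exact mul_ne_zero (pow_ne_zero _ (pow_ne_zero _ (by norm_num))) hdetC
  have hrank : (M.submatrix ρ γ).rank = 4 := by
    rw [Matrix.rank_of_isUnit _ hunit, Fintype.card_fin]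
  calc 4 = (M.submatrix ρ γ).rank := hrank.symm
    _ ≤ M.rank := Matrix.rank_submatrix_le M ρ γ

/-! ### §4 Counting: a balanced word has a window with two or three row letters -/

/-- `#{k < N : p k} + #{k < N : ¬ p k} = N`. [folklore] -/
theorem count_add_count_not (p : ℕ → Prop) [DecidablePred p] (N : ℕ) :
    Nat.count p N + Nat.count (fun k => ¬ p k) N = N := by
  induction N with
  | zero => simp
  | succ N ih =>
    by_cases h : p N <;>
      simp only [Nat.count_succ, h, if_true, if_false, not_true_eq_false, not_false_eq_true] <;> omega

/-- Consecutive length-5 window counts differ by at most one (the windows share four positions).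
[folklore] -/
theorem count_window_succ (p : ℕ → Prop) [DecidablePred p] (s : ℕ) :
    Nat.count (fun k => p (s + 1 + k)) 5 ≤ Nat.count (fun k => p (s + k)) 5 + 1 ∧
    Nat.count (fun k => p (s + k)) 5 ≤ Nat.count (fun k => p (s + 1 + k)) 5 + 1 := by
  simp only [Nat.count_succ, Nat.count_zero, add_zero, add_assoc, Nat.reduceAdd]
  split_ifs <;> omega

/-- **Block count.** If every length-5 window of `[0, N)` (`N ≥ 5`) contains at most one `k` with
`p k`, then `#{k < N : p k} ≤ N/5 + 1` (peel off the last five positions). [folklore] -/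
theorem count_le_of_sparse_windows (p : ℕ → Prop) [DecidablePred p] (N : ℕ) (hN : 5 ≤ N)
    (h : ∀ s, s + 5 ≤ N → Nat.count (fun k => p (s + k)) 5 ≤ 1) :
    Nat.count p N ≤ N / 5 + 1 := by
  induction N using Nat.strong_induction_on with
  | _ N ih =>
    obtain ⟨t, rfl⟩ : ∃ t, N = t + 5 := ⟨N - 5, by omega⟩
    rw [Nat.count_add]
    have hlast := h t le_rfl
    by_cases ht : 5 ≤ t
    · have := ih t (by omega) ht (fun s hs => h s (by omega))
      omega
    · have h0 : Nat.count (fun k => p k) 5 ≤ 1 := by simpa using h 0 (by omega)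
      have hmono : Nat.count p t ≤ Nat.count p 5 := Nat.count_monotone p (by omega)
      have h0' : Nat.count p 5 ≤ 1 := h0
      omega

/-- **Counting lemma.** If `n ≥ 3` and both `p` and `¬ p` hold at `≥ n` of the positions `< 2n`
(a balanced word), some length-5 window `s, …, s+4 < 2n` contains exactly two or three `k` with `p k`:
window counts move by `≤ 1`, so avoiding `{2, 3}` keeps every window at `≤ 1` or every window at
`≥ 4`, and then `p` resp. `¬ p` holds at `≤ 2n/5 + 1 < n` positions. [folklore] -/
theorem exists_good_window (p : ℕ → Prop) [DecidablePred p] (n : ℕ) (hn : 3 ≤ n)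
    (hR : n ≤ Nat.count p (2 * n)) (hC : n ≤ Nat.count (fun k => ¬ p k) (2 * n)) :
    ∃ s, s + 5 ≤ 2 * n ∧
      (Nat.count (fun k => p (s + k)) 5 = 2 ∨ Nat.count (fun k => p (s + k)) 5 = 3) := by
  by_contra hno
  push Not at hno
  -- every window count is `≤ 1` or `≥ 4`
  have hdich : ∀ s, s + 5 ≤ 2 * n →
      Nat.count (fun k => p (s + k)) 5 ≤ 1 ∨ 4 ≤ Nat.count (fun k => p (s + k)) 5 := by
    intro s hs
    have := hno s hs
    have h5 : Nat.count (fun k => p (s + k)) 5 ≤ 5 := Nat.count_le _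
    omega
  -- the two regimes do not mix
  have hregime : (∀ s, s + 5 ≤ 2 * n → Nat.count (fun k => p (s + k)) 5 ≤ 1) ∨
      (∀ s, s + 5 ≤ 2 * n → 4 ≤ Nat.count (fun k => p (s + k)) 5) := by
    rcases hdich 0 (by omega) with h0 | h0
    · left
      intro s
      induction s with
      | zero => exact fun _ => h0
      | succ s ih =>
        intro hs
        have h1 := ih (by omega)
        have h2 := (count_window_succ p s).1
        rcases hdich (s + 1) hs with h3 | h3 <;> omega
    · right
      intro s
      induction s with
      | zero => exact fun _ => h0
      | succ s ih =>
        intro hs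
        have h1 := ih (by omega)
        have h2 := (count_window_succ p s).2
        rcases hdich (s + 1) hs with h3 | h3 <;> omega
  rcases hregime with hle | hge
  · have := count_le_of_sparse_windows p (2 * n) (by omega) hle
    omega
  · have hle' : ∀ s, s + 5 ≤ 2 * n → Nat.count (fun k => ¬ p (s + k)) 5 ≤ 1 := by
      intro s hs
      have h1 := hge s hs
      have h2 := count_add_count_not (fun k => p (s + k)) 5
      omega
    have := count_le_of_sparse_windows (fun k => ¬ p k) (2 * n) (by omega) hle'
    omega

/-! ### §5 Assembly -/

/-- A cut `π : Fin n ⊕ Fin n ≃ Fin (2n)` has (at least) `n` row positions among `0, …, 2n-1`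
(the images of `Sum.inl`). [folklore] -/
theorem le_count_isLeft (n : ℕ) (π : Fin n ⊕ Fin n ≃ Fin (2 * n)) :
    n ≤ Nat.count (fun j => (if h : j < 2 * n then (π.symm ⟨j, h⟩).isLeft else false) = true) (2 * n) := by
  rw [Nat.count_eq_card_filter_range]
  have hinj : Function.Injective (fun i : Fin n => ((π (Sum.inl i) : Fin (2 * n)) : ℕ)) := by
    intro i i' h
    exact Sum.inl_injective (π.injective (Fin.ext h))
  calc n = (Finset.univ.image (fun i : Fin n => ((π (Sum.inl i) : Fin (2 * n)) : ℕ))).card := by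
        rw [Finset.card_image_of_injective _ hinj, Finset.card_univ, Fintype.card_fin]
    _ ≤ _ := Finset.card_le_card ?_
  intro j hj
  rw [Finset.mem_image] at hj
  obtain ⟨i, _, rfl⟩ := hj
  rw [Finset.mem_filter, Finset.mem_range]
  refine ⟨(π (Sum.inl i)).isLt, ?_⟩
  rw [dif_pos (π (Sum.inl i)).isLt, Fin.eta, Equiv.symm_apply_apply, Sum.isLeft_inl]

/-- A cut `π : Fin n ⊕ Fin n ≃ Fin (2n)` has (at least) `n` column positions among `0, …, 2n-1`
(the images of `Sum.inr`). [folklore] -/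
theorem le_count_not_isLeft (n : ℕ) (π : Fin n ⊕ Fin n ≃ Fin (2 * n)) :
    n ≤ Nat.count (fun j => ¬ (if h : j < 2 * n then (π.symm ⟨j, h⟩).isLeft else false) = true) (2 * n) := by
  rw [Nat.count_eq_card_filter_range]
  have hinj : Function.Injective (fun i : Fin n => ((π (Sum.inr i) : Fin (2 * n)) : ℕ)) := by
    intro i i' h
    exact Sum.inr_injective (π.injective (Fin.ext h))
  calc n = (Finset.univ.image (fun i : Fin n => ((π (Sum.inr i) : Fin (2 * n)) : ℕ))).card := by
        rw [Finset.card_image_of_injective _ hinj, Finset.card_univ, Fintype.card_fin]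
    _ ≤ _ := Finset.card_le_card ?_
  intro j hj
  rw [Finset.mem_image] at hj
  obtain ⟨i, _, rfl⟩ := hj
  rw [Finset.mem_filter, Finset.mem_range]
  refine ⟨(π (Sum.inr i)).isLt, ?_⟩
  rw [dif_pos (π (Sum.inr i)).isLt, Fin.eta, Equiv.symm_apply_apply, Sum.isLeft_inr]
  exact Bool.false_ne_true

open Summit.ValiantsHypothesis.ValiantsHypothesis.Theses.LiouvilleSarnak in
/-- **`LiouvilleCutRankFour` (stmt-ValiantsHypothesis-21039), PROVED** with `n₀ = 3`: for every
`n ≥ 3` and every balanced cut `π` of the `2n` bit positions, the digital cut matrix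
`(λ(N_π(r,c) + 1))_{r,c}` of the Liouville function has rank `≥ 4` over `ℂ`. Assembly of the
counting lemma (§4: a window with two or three row bits exists), the certificate (§2) and the
window embedding (§3). [folklore] -/
theorem liouvilleCutRankFour_proof : LiouvilleCutRankFour := by
  refine ⟨3, fun n hn π => ?_⟩
  obtain ⟨s, hs, hcnt⟩ := exists_good_window
    (fun j => (if h : j < 2 * n then (π.symm ⟨j, h⟩).isLeft else false) = true) n hn
    (le_count_isLeft n π) (le_count_not_isLeft n π)
  have hmk : ∀ j : Fin (2 * n), s ≤ (j : ℕ) → (j : ℕ) < s + 5 →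
      Nat.testBit (Nat.ofBits (fun k : Fin 5 => (π.symm ⟨s + k, by omega⟩).isLeft)) (j - s) =
        (π.symm j).isLeft := by
    intro j h1 h2
    have e : (⟨s + ((j : ℕ) - s), by omega⟩ : Fin (2 * n)) = j :=
      Fin.ext (show s + ((j : ℕ) - s) = (j : ℕ) by omega)
    rw [Nat.testBit_ofBits_lt _ _ (show (j : ℕ) - s < 5 by omega)]
    dsimp only
    rw [e]
  have hcount : Nat.count (fun k => Nat.testBit
        (Nat.ofBits (fun k : Fin 5 => (π.symm ⟨s + k, by omega⟩).isLeft)) k = true) 5 =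
      Nat.count (fun j => (if h : s + j < 2 * n then (π.symm ⟨s + j, h⟩).isLeft else false) = true) 5 := by
    apply le_antisymm <;> refine Nat.count_mono_left (fun k hk hpk => ?_)
    · rw [dif_pos (show s + k < 2 * n by omega)]
      rw [Nat.testBit_ofBits_lt _ _ hk] at hpk
      exact hpk
    · rw [dif_pos (show s + k < 2 * n by omega)] at hpk
      rw [Nat.testBit_ofBits_lt _ _ hk]
      exact hpk
  refine four_le_rank_of_window n π s hs _ _ _ hmk
    (cert_det_ne_zero _ (Nat.ofBits_lt_two_pow _) ?_)
  rw [hcount]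
  exact hcnt

end Summit.ValiantsHypothesis.ValiantsHypothesis.Theorems.LiouvilleSarnakCutRankFour
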